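import Summits.BirchSwinnertonDyer.BirchSwinnertonDyer.Theses.ByReductionTypeAtTwo
import Summits.BirchSwinnertonDyer.BirchSwinnertonDyer.Theorems.ByReductionTypeAtTwoMultGlue
import Summits.BirchSwinnertonDyer.BirchSwinnertonDyer.Theorems.ByReductionTypeAtTwoAdditiveKatoFineConjAAbelianTwoDivision
import Literature.NumberTheory.EllipticCurves.Kato2004.SemistableRankZeroShaUpperBoundFineSelmerAtTwoSharp
import Literature.NumberTheory.EllipticCurves.Rank1Residual.Typed.CasselsLowerBound
import Literature.NumberTheory.EllipticCurves.PAdicHeightsProofs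
import HarnessLib

/-!
# Crux `AdditiveRankZeroAtTwo` (K4 item 19098) and its sibling's upper half `MultUpperHalfAtTwo` (item 19922):
# KATO AT `2` OVER THE SEMISTABILISING FIELD, COMPONENTWISE — the Kato half `MissingUpperBoundAt W 2` at a MULTIPLICATIVE
# `2` for IRREDUCIBLE `E[2]`, from Coates–Sujatha's statement (A) at `(E,2)` alone; the crux
# `MultUpperHalfAtTwo` BY NAME from that reading + (A) on the non-abelian-`ℚ(E[2])` irreducible classes + its REDUCIBLE
# residual (seat `bsd-2adic-addL2x` GEN 14; `--supports`; outside the route file's import cone)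

HONEST FRAMING (cell `bsd-2adic`, HUMAN RULING D-0036/D-0054): types-the-object-of; closes none at the ∀-level; nothing
booked; BSD is not proved by any of this. Conditional helpers; no item is closed by this file. PARTITION: the files of
lane `bsd-2adic-mult-2` (registered line `four_roads` of 19922, its `MultUpperHalvesAtTwo.*` leaves) are NOT touched or
restated; this file offers a by-name door on the irreducible-`E[2]` locus and says so.

WHY (lane B's road, leg (ii) «Kato's divisibility over the semistabilising field», read componentwise). GEN 13's glue
v7 (`additiveRankZeroAtTwo_of_residual_v7`, p656665) confines the over-`K` child C4″ of the additive crux to the 169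
census classes whose twist by `−1` is SPLIT multiplicative at `2` (+ exceptions) and consumes the sibling
`MultiplicativeRankZeroAtTwo` BY NAME for their twist partners. Over `K = ℚ(i) ⊂ ℚ(ζ_{2^∞})` — INSIDE Kato's tower —
such a curve `E` and its partner `E' = E^{(−1)}` (split multiplicative at `2`) are the two components of ONE
`Λ`-module, and the lane's SHARP Kato-at-`2` reading (T1–T16) holds for the `E'`-component: the Literature facts
`Kato2004.rankZero_padicValNat_sha_add_padicValNat_tamagawa_le_at_two_of_multiplicative_of_irreducible_of_fineSelmerDual_fg`
and `…_of_good_…` (file `Kato2004/SemistableRankZeroShaUpperBoundFineSelmerAtTwoSharp.lean`, this seat GEN 14, p658927;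
flags `Kato-12.5(1)(3)-(12.5.1)-13.13-T3-T8-T9-at-two-multiplicative-irreducible-fineSelmer-fg-sharp`,
`Kato-12.5(1)(3)-(12.5.1)-T8-T9-at-two-good-irreducible-fineSelmer-fg-sharp`; D-audit owed): at a SEMISTABLE `2` the
three reduction-dependent steps are (M-T3) the local term of Kato's Thm. 12.5 (3) — `0` at a good or non-split `2`, and
at a split `2` supported at the `σ_{−1} = −1` prime `ker(κ^{−1})`, never met by T3's `e₊`-localisation —, (M-T8) Tate's
measure `μ_ω(E(ℚ₂)) = c₂·#Ẽ_ns(𝔽₂)/2` and (M-T9) Kato's depleted value `L_{(2)}(E,1) = L(E,1)·L_2(E,1)^{−1}`, and the last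
two CANCEL (`L_2(E,1)^{−1} = #Ẽ_ns(𝔽₂)/2`). So the rank-`0` Euler-system half at `2` is ONE statement across the
semistable/additive divide, modulo (A) and irreducibility of `E[2]`.

* §1 `padicValNat_shaOrder_le_of_katoAtTwoMult_rankZero` — the multiplicative reading in Miller's currency:
  `#Ш_an = q`, `ord₂ #Ш ≤ ord₂ q − 2·ord₂ #E(ℚ)_tors` (proof word for word as GEN 13's
  `AddKatoTwo.padicValNat_shaOrder_le_of_katoAtTwoNoSplitTwist_rankZero`).
* §2 `missingUpperBoundAt_two_of_katoAtTwoMult` — THE KATO HALF AT A MULTIPLICATIVE `2`: non-CM, `r_an = 0`, `Mult W 2`,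
  `E[2]` irreducible, (A) at `(W,2)` ⟹ `MissingUpperBoundAt W 2`; `…_of_isAbelianGalois` — (A) DISCHARGED from print
  (Lim 2017 Thm. 3.5 at `2` + Ferrero–Washington, GEN 9's `conjA_two_of_isAbelianGalois_divisionField_two`) when `ℚ(E[2])`
  is abelian (cyclic cubic image; mult-2 census: 2 classes). (The GOOD-reduction twins go to a sibling file.)
* §3 `bsdp_two_of_katoAtTwoMult_of_lower` / `bsdp_two_iff_lower_of_katoAtTwoMult` — BSD₂ at such a curve ⟺ the LOWER
  half over `ℚ` (`MultLowerHalfAtTwo`'s content at the curve); i.e. on the irreducible-`E[2]` multiplicative classes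
  the sibling `MultiplicativeRankZeroAtTwo` that v7 consumes is ONE-SIDED modulo (A), exactly like the additive block.
* §4 BLOCK forms keyed like the children of 19096: `multTwo_upper_onIrreducible_of_conjA` (the Kato half on
  {`Mult W 2` ∧ irreducible} from the reading + PRINT + (A) on the non-abelian part `hAnaMult`) and
  `multUpperHalfAtTwo_of_katoAtTwoMult_of_conjA_of_reducible` — the crux `MultUpperHalfAtTwo` (19922) BY NAME from
  {reading `hKM`, `hGZK`, `hmod`, `hLim2`, `hFW`, (A) on the irreducible non-abelian classes `hAnaMult`, and the REDUCIBLE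
  residual `hRedMult` = the upper half on the multiplicative curves with a rational `2`-torsion point}. Census (mult-2,
  PROOF-KATO2MULT S0-3 / four_roads): 1 673 of the 1 969 rank-`0` multiplicative classes have irreducible `E[2]`
  (1 678 `S₃` + 2 `C₃` minus 7 of rank 1), 296 are reducible (154 Prop-5.14 + 142 «neither»); the 52 «small `2`-adic
  image» irreducible classes, for which the registered line has no Euler-system door (Rubin's Hyp(ℚ_∞,T) fails), are
  INSIDE the irreducible locus of this door (no `2`-adic surjectivity is asked).
* §5 `multTwo_bsdp_onIrreducible_of_conjA_of_lower` — for the additive crux's glue: BSD₂ of a multiplicative twist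
  partner with irreducible `E[2]` from (A) + its lower half (the two one-sided objects), so that on the 169-class
  (−1)-split sub-block v7's sibling input is {(A), lower half} of the partner `W^{(d)}` (`d ≡ 7 mod 8`,
  `L(E^{(d)},1) ≠ 0` by Hoffstein–Luo), never an over-`K` C-part; and
  `multiplicativeRankZeroAtTwo_of_katoAtTwoMult_of_conjA_of_reducible_of_lower` — the whole sibling
  `MultiplicativeRankZeroAtTwo` from the PROVED glue 19924 + §4 + `MultLowerHalfAtTwo`.

Binders (BY NAME): `hKM` = the multiplicative reading (Literature, p658927; this file consumes only that one); `hGZK`; `hmod`;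
`hLim2`, `hFW` (abelian case).
Memo: `run/shared/lean/pub/bsd-2adic/addL2x/VERDICT-19098-addL2x-GEN14.md`.

References: [Kato2004Asterisque] Thm. 12.5 (1)(3), (12.5.1) (pp. 221–222), 13.8 (pp. 227–229), 13.13 (pp. 233–234),
13.14 (p. 234), 14.13–14.16 (pp. 242–245); [SilvermanATAEC1994] V.3, V.5.2, V.5.3, Ex. 5.11; [SilvermanAEC2009] IV.6.4,
VII.2.1, VII.6.1, X.4.14; [Tate1975] §1; [CoatesSujatha2005] statement (A); [Lim2017FineSelmer] §3 Thm. 3.5;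
[FerreroWashington1979]; [Miller2011LMS] Def. 1.1.
-/

set_option autoImplicit false
-- sibling precedent (`ByReductionTypeAtTwoAdditivePotMultKatoHalf.lean`): the directory name repeats the summit name
set_option linter.dupNamespace false

noncomputable section

open scoped Classical

namespace Summit.BirchSwinnertonDyer.BirchSwinnertonDyer.Theorems.SemistableKatoTwo

open WeierstrassCurve Literature.NumberTheory.EllipticCurves
  Literature.NumberTheory.EllipticCurves.Rank1Residual
  Literature.NumberTheory.EllipticCurves.Rank1Residual.Typed
  Literature.NumberTheory.IwasawaTheory
  Summit.BirchSwinnertonDyer.BirchSwinnertonDyer.Theses.ByReductionTypeAtTwo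
  Summit.BirchSwinnertonDyer.BirchSwinnertonDyer.Theorems.AddKatoTwo

/-! ## §1 The reading in Miller's currency -/

/-- **Rank-`0` upper bound from the `p = 2` reading at a MULTIPLICATIVE `2`**: for a non-CM globally minimal `W`,
multiplicative at `2` (split or non-split), with `E[2]` irreducible, `r_an = 0` and statement (A) at `(E,2)` (`hA`):
`#Ш_an = q` and `ord₂ #Ш ≤ ord₂ q − 2·ord₂ #E(ℚ)_tors` (the reading bounds `ord₂ #Ш + v₂(∏ c_ℓ)` by `ord₂(L/Ω)` and
`#Ш_an = (L/Ω)·#tors²/∏ c_ℓ`). Proof word for word as `AddKatoTwo.padicValNat_shaOrder_le_of_katoAtTwoNoSplitTwist_rankZero`.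
[cite: Kato2004Asterisque, Thm. 12.5 (1)(3) (pp. 221–222), (12.5.1) (p. 222), 13.13 (pp. 233–234), 14.14 and Lemma 14.15 (pp. 243–244)]
[cite: Tate1975, §1] [cite: CoatesSujatha2005, statement (A)] [cite: Miller2011LMS, Def. 1.1] -/
theorem padicValNat_shaOrder_le_of_katoAtTwoMult_rankZero
    (hKM : Kato2004.rankZero_padicValNat_sha_add_padicValNat_tamagawa_le_at_two_of_multiplicative_of_irreducible_of_fineSelmerDual_fg)
    (hGZK : rank_eq_analyticRank_of_analyticRank_le_one) (hmod : hasEntireLFunction_rat)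
    (W : WeierstrassCurve ℚ) [W.IsElliptic] [W.IsGloballyMinimal] (hcm : ¬ W.HasCM)
    (hmult : W.HasMultiplicativeReductionAtPrime 2)
    (hirr : W.HasIrreducibleModPGaloisRep 2)
    (hA : ∀ (κ : ZpExtension ℚ 2), κ.IsCyclotomic →
      ∃ (γ : Field.absoluteGaloisGroup ℚ) (D : W.FineSelmerDualData κ γ),
        Module.Finite ℤ_[2] (RestrictScalars ℤ_[2] (IwasawaAlgebra 2) D.X))
    (hr : W.analyticRank = 0) :
    ∃ q : ℚ, shaAn W = (q : ℂ) ∧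
      (padicValNat 2 W.shaOrder : ℤ) ≤ padicValRat 2 q - 2 * padicValNat 2 W.torsionOrder := by
  have hL : W.entireLFunction 1 ≠ 0 := (W.analyticRank_eq_zero_iff_holds (hmod W)).mp hr
  obtain ⟨hmw, hfin⟩ := hGZK W (by rw [hr]; exact zero_le_one)
  haveI : Finite W.sha := hfin
  have hmw0 : W.mordellWeilRank = 0 := by rw [hmw, hr]
  obtain ⟨q₀, hq₀, hle⟩ := hKM W hcm hmult hirr hA hL hfin
  have hΩpos : 0 < W.realPeriodRat := W.realPeriodRat_pos_holds
  have hΩ : (W.realPeriodRat : ℂ) ≠ 0 := by exact_mod_cast hΩpos.ne'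
  have hc0 : 0 < W.tamagawaProduct := W.tamagawaProduct_pos_holds
  have ht0 : 0 < W.torsionOrder := W.torsionOrder_pos_holds
  have hq₀0 : q₀ ≠ 0 := by
    rintro rfl
    rw [Rat.cast_zero, div_eq_zero_iff] at hq₀
    exact hq₀.elim hL hΩ
  refine ⟨q₀ * (W.torsionOrder : ℚ) ^ 2 / (W.tamagawaProduct : ℚ), ?_, ?_⟩
  · have hLq : W.entireLFunction 1 = (q₀ : ℂ) * (W.realPeriodRat : ℂ) := by
      rw [← hq₀, div_mul_cancel₀ _ hΩ]
    rw [shaAn_def, leadingLCoeff_eq_of_analyticRank_eq_zero W hr,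
      W.regulator_eq_one_of_rank_zero hmw0, hLq]
    push_cast
    field_simp
  · have ht : (W.torsionOrder : ℚ) ≠ 0 := by exact_mod_cast ht0.ne'
    have hcq : (W.tamagawaProduct : ℚ) ≠ 0 := by exact_mod_cast hc0.ne'
    have hsha : padicValNat 2 (Nat.card (AddCommGroup.primaryComponent W.sha 2)) =
        padicValNat 2 W.shaOrder := by
      unfold WeierstrassCurve.shaOrder
      exact padicValNat_card_addPrimaryComponent 2
    have hv : padicValRat 2 (q₀ * (W.torsionOrder : ℚ) ^ 2 / (W.tamagawaProduct : ℚ)) =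
        padicValRat 2 q₀ + 2 * (padicValNat 2 W.torsionOrder : ℤ) -
          (padicValNat 2 W.tamagawaProduct : ℤ) := by
      rw [padicValRat.div (mul_ne_zero hq₀0 (pow_ne_zero 2 ht)) hcq,
        padicValRat.mul hq₀0 (pow_ne_zero 2 ht), pow_two, padicValRat.mul ht ht,
        padicValRat.of_nat, padicValRat.of_nat]
      ring
    rw [hv, ← hsha]
    linarith

/-! ## §2 The KATO HALF at a multiplicative `2`, from statement (A) alone -/

/-- **The Kato half at a curve with MULTIPLICATIVE reduction at `2` (split or non-split) from statement (A) at
`(E,2)`.** Granted the reading `hKM`, GZK and modularity: for `W` non-CM, globally minimal, `r_an = 0`, `Mult W 2`, with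
`E[2]` irreducible, (A) at `(W,2)` gives `MissingUpperBoundAt W 2` (torsion term `0` by irreducibility). No `2`-adic
surjectivity, no sign of `Δ`, no `μ`-certificate, no `2`-adic `L`-function, no Cassels–Tate. [cite: Kato2004Asterisque, Thm. 12.5 (1)(3) (pp. 221–222), (12.5.1) (p. 222), 13.8 (pp. 227–229), 13.13–13.14 (pp. 233–234), 14.14 (p. 243)]
[cite: SilvermanATAEC1994, Thm. V.5.3 and Exercise 5.11] [cite: Tate1975, §1] [cite: CoatesSujatha2005, statement (A)] [cite: Miller2011LMS, Def. 1.1] -/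
theorem missingUpperBoundAt_two_of_katoAtTwoMult
    (hKM : Kato2004.rankZero_padicValNat_sha_add_padicValNat_tamagawa_le_at_two_of_multiplicative_of_irreducible_of_fineSelmerDual_fg)
    (hGZK : rank_eq_analyticRank_of_analyticRank_le_one) (hmod : hasEntireLFunction_rat)
    (W : WeierstrassCurve ℚ) [W.IsElliptic] [W.IsGloballyMinimal] (hcm : ¬ W.HasCM) (hr : W.analyticRank = 0)
    (hmult : Mult W 2) (hirr : W.HasIrreducibleModPGaloisRep 2)
    (hA : ∀ (κ : ZpExtension ℚ 2), κ.IsCyclotomic →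
      ∃ (γ : Field.absoluteGaloisGroup ℚ) (D : W.FineSelmerDualData κ γ),
        Module.Finite ℤ_[2] (RestrictScalars ℤ_[2] (IwasawaAlgebra 2) D.X)) :
    MissingUpperBoundAt W 2 := by
  haveI : Fact (Nat.Prime 2) := ⟨Nat.prime_two⟩
  obtain ⟨q, hq, hle⟩ :=
    padicValNat_shaOrder_le_of_katoAtTwoMult_rankZero hKM hGZK hmod W hcm hmult hirr hA hr
  rw [padicValNat_torsionOrder_eq_zero_of_irreducible W 2 hirr] at hle
  simp only [Nat.cast_zero, mul_zero, sub_zero] at hle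
  exact ⟨q, hq, hle⟩

/-- **The Kato half at a MULTIPLICATIVE `2` with statement (A) DISCHARGED from print when `ℚ(E[2])` is abelian**
(irreducible `E[2]` with cyclic cubic image; mult-2 census: 2 classes): Lim 2017 Thm. 3.5 at `2` + Ferrero–Washington BY
NAME through GEN 9's `conjA_two_of_isAbelianGalois_divisionField_two` (reduction-type-free). On such curves the Kato half
rests on PRINT + the one reading only. [cite: Lim2017FineSelmer, §3 Thm. 3.5] [cite: FerreroWashington1979, Theorem]
[cite: Kato2004Asterisque, Thm. 12.5 (3) and (12.5.1) (p. 222), 13.13 (p. 233)] -/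
theorem missingUpperBoundAt_two_of_katoAtTwoMult_of_isAbelianGalois
    (hKM : Kato2004.rankZero_padicValNat_sha_add_padicValNat_tamagawa_le_at_two_of_multiplicative_of_irreducible_of_fineSelmerDual_fg)
    (hGZK : rank_eq_analyticRank_of_analyticRank_le_one) (hmod : hasEntireLFunction_rat)
    (hLim2 : Lim2017.thm35_at_two_fineSelmerDual_moduleFinite_of_classicalMuVanishes_of_le_divisionField_four)
    (hFW : ferreroWashington1979_classicalMuVanishes)
    (W : WeierstrassCurve ℚ) [W.IsElliptic] [W.IsGloballyMinimal] (hcm : ¬ W.HasCM) (hr : W.analyticRank = 0)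
    (hmult : Mult W 2) (hirr : W.HasIrreducibleModPGaloisRep 2) (hab : IsAbelianGalois ℚ (W.divisionField 2)) :
    MissingUpperBoundAt W 2 := by
  haveI := hab
  exact missingUpperBoundAt_two_of_katoAtTwoMult hKM hGZK hmod W hcm hr hmult hirr
    (conjA_two_of_isAbelianGalois_divisionField_two hLim2 hFW W)

/-! ## §3 BSD₂ at a multiplicative `2`: statement (A) + the LOWER half over `ℚ` -/

/-- **BSD₂ at a curve multiplicative at `2` with irreducible `E[2]` from statement (A) at `(E,2)` and the LOWER half
over `ℚ`.** The upper half by `missingUpperBoundAt_two_of_katoAtTwoMult`; with `MissingLowerBoundAt W 2` (however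
obtained) `missingPPartAt_of_lower_of_upper` + `bsdp_of_missingPPartAt` give `BSDp W 2`. [cite: Kato2004Asterisque, Thm. 12.5 (1)(3) (pp. 221–222), 13.13 (p. 233), 14.14 (p. 243)]
[cite: CoatesSujatha2005, statement (A)] [cite: Miller2011LMS, §1 and Def. 1.1] -/
theorem bsdp_two_of_katoAtTwoMult_of_lower
    (hKM : Kato2004.rankZero_padicValNat_sha_add_padicValNat_tamagawa_le_at_two_of_multiplicative_of_irreducible_of_fineSelmerDual_fg)
    (hGZK : rank_eq_analyticRank_of_analyticRank_le_one) (hmod : hasEntireLFunction_rat)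
    (W : WeierstrassCurve ℚ) [W.IsElliptic] [W.IsGloballyMinimal] (hcm : ¬ W.HasCM) (hr : W.analyticRank = 0)
    (hmult : Mult W 2) (hirr : W.HasIrreducibleModPGaloisRep 2)
    (hA : ∀ (κ : ZpExtension ℚ 2), κ.IsCyclotomic →
      ∃ (γ : Field.absoluteGaloisGroup ℚ) (D : W.FineSelmerDualData κ γ),
        Module.Finite ℤ_[2] (RestrictScalars ℤ_[2] (IwasawaAlgebra 2) D.X))
    (hlow : MissingLowerBoundAt W 2) : BSDp W 2 := by
  have hr1 : W.analyticRank ≤ 1 := by rw [hr]; exact zero_le_one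
  exact bsdp_of_missingPPartAt W 2 hGZK hr1
    (missingPPartAt_of_lower_of_upper W 2 hlow
      (missingUpperBoundAt_two_of_katoAtTwoMult hKM hGZK hmod W hcm hr hmult hirr hA))

/-- **Not lossy**: granted the Kato half at a multiplicative `2`, `BSD₂(W)` is EQUIVALENT to the lower half over `ℚ`
(`missingPPartAt_of_bsdp`; `Ш` finite by GZK in rank `0`). On the irreducible-`E[2]` multiplicative classes the sibling
`MultiplicativeRankZeroAtTwo` is therefore ONE-SIDED modulo (A), as the additive block is. Bookkeeping.
[cite: Miller2011LMS, §1 and Def. 1.1] -/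
theorem bsdp_two_iff_lower_of_katoAtTwoMult
    (hKM : Kato2004.rankZero_padicValNat_sha_add_padicValNat_tamagawa_le_at_two_of_multiplicative_of_irreducible_of_fineSelmerDual_fg)
    (hGZK : rank_eq_analyticRank_of_analyticRank_le_one) (hmod : hasEntireLFunction_rat)
    (W : WeierstrassCurve ℚ) [W.IsElliptic] [W.IsGloballyMinimal] (hcm : ¬ W.HasCM) (hr : W.analyticRank = 0)
    (hmult : Mult W 2) (hirr : W.HasIrreducibleModPGaloisRep 2)
    (hA : ∀ (κ : ZpExtension ℚ 2), κ.IsCyclotomic →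
      ∃ (γ : Field.absoluteGaloisGroup ℚ) (D : W.FineSelmerDualData κ γ),
        Module.Finite ℤ_[2] (RestrictScalars ℤ_[2] (IwasawaAlgebra 2) D.X)) :
    BSDp W 2 ↔ MissingLowerBoundAt W 2 := by
  haveI : Fact (Nat.Prime 2) := ⟨Nat.prime_two⟩
  have hr1 : W.analyticRank ≤ 1 := by rw [hr]; exact zero_le_one
  constructor
  · intro h
    haveI : Finite W.sha := (hGZK W hr1).2
    exact (lower_and_upper_of_missingPPartAt W 2 (missingPPartAt_of_bsdp W 2 h)).1
  · exact bsdp_two_of_katoAtTwoMult_of_lower hKM hGZK hmod W hcm hr hmult hirr hA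

/-! ## §4 The BLOCK forms on the multiplicative block, keyed like the children of `MultiplicativeRankZeroAtTwo` -/

/-- **The Kato half on the multiplicative `E[2]`-IRREDUCIBLE block at `2`**: for every non-CM globally minimal `W` of
analytic rank `0`, multiplicative at `2`, with `E[2]` irreducible: `MissingUpperBoundAt W 2`, GRANTED the reading
`hKM`, GZK, modularity, Lim@2 + FW (abelian `ℚ(E[2])`), and statement (A) at `(W,2)` on the curves of the block whose
`2`-division field is NOT abelian (`hAnaMult`, the C1″-shaped research input on THIS block — Iwasawa's `μ₂ = 0` for the
`S₃`-sextics `ℚ(W[2])`, by the class-group criterion, exactly as k4-w1's Heart file prices C1″ on the additive block).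
No `2`-adic surjectivity, no `Δ`-sign, no `μ(X)`-certificate. Conditional; closes nothing. [cite: Kato2004Asterisque, Thm. 12.5 (3) and (12.5.1) (p. 222), 13.13 (p. 233), 14.14 (p. 243)]
[cite: CoatesSujatha2005, statement (A)] [cite: Lim2017FineSelmer, §3 Thm. 3.5] [cite: FerreroWashington1979, Theorem] -/
theorem multTwo_upper_onIrreducible_of_conjA
    (hKM : Kato2004.rankZero_padicValNat_sha_add_padicValNat_tamagawa_le_at_two_of_multiplicative_of_irreducible_of_fineSelmerDual_fg)
    (hGZK : rank_eq_analyticRank_of_analyticRank_le_one) (hmod : hasEntireLFunction_rat)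
    (hLim2 : Lim2017.thm35_at_two_fineSelmerDual_moduleFinite_of_classicalMuVanishes_of_le_divisionField_four)
    (hFW : ferreroWashington1979_classicalMuVanishes)
    (hAnaMult : ∀ (W : WeierstrassCurve ℚ) [W.IsElliptic] [W.IsGloballyMinimal], ¬ W.HasCM → W.analyticRank = 0 →
      Mult W 2 → W.HasIrreducibleModPGaloisRep 2 → ¬ IsAbelianGalois ℚ (W.divisionField 2) →
      ∀ (κ : ZpExtension ℚ 2), κ.IsCyclotomic →
        ∃ (γ : Field.absoluteGaloisGroup ℚ) (D : W.FineSelmerDualData κ γ),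
          Module.Finite ℤ_[2] (RestrictScalars ℤ_[2] (IwasawaAlgebra 2) D.X)) :
    ∀ (W : WeierstrassCurve ℚ) [W.IsElliptic] [W.IsGloballyMinimal], ¬ W.HasCM → W.analyticRank = 0 →
      Mult W 2 → W.HasIrreducibleModPGaloisRep 2 → MissingUpperBoundAt W 2 := by
  intro W _ _ hcm hr hmult hirr
  by_cases hab : IsAbelianGalois ℚ (W.divisionField 2)
  · exact missingUpperBoundAt_two_of_katoAtTwoMult_of_isAbelianGalois hKM hGZK hmod hLim2 hFW W hcm hr hmult hirr hab
  · exact missingUpperBoundAt_two_of_katoAtTwoMult hKM hGZK hmod W hcm hr hmult hirr (hAnaMult W hcm hr hmult hirr hab)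

/-- **The crux `MultUpperHalfAtTwo` (item 19922) BY NAME from the reading, statement (A) on the irreducible
non-abelian classes, and the REDUCIBLE residual.** Inputs: READING {`hKM`} + PRINT {`hGZK`, `hmod`, `hLim2`, `hFW`} +
research `∀`-objects {`hAnaMult` = (A) at `(W,2)` on the multiplicative rank-`0` curves with irreducible `E[2]` and
non-abelian `ℚ(E[2])`; `hRedMult` = the upper half on the multiplicative rank-`0` curves with REDUCIBLE `E[2]` (a rational
point of order `2`; census 296/1 969 classes: 154 Prop-5.14 + 142 «neither» — the habitat of Greenberg's Props.
5.13/5.14 and of the registered line's μ-roads)}. A by-name door offered to the lane of record (`four_roads`); it does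
not replace or restate its stubs. Conditional; closes nothing by itself. [cite: Kato2004Asterisque, Thm. 12.5 (3) and (12.5.1) (p. 222), 13.13 (p. 233), 14.14 (p. 243)]
[cite: CoatesSujatha2005, statement (A)] [cite: Lim2017FineSelmer, §3 Thm. 3.5] [cite: FerreroWashington1979, Theorem]
[cite: GreenbergLNM1716, Prop. 5.13 and Prop. 5.14 (shape of the reducible residual)] -/
theorem multUpperHalfAtTwo_of_katoAtTwoMult_of_conjA_of_reducible
    (hKM : Kato2004.rankZero_padicValNat_sha_add_padicValNat_tamagawa_le_at_two_of_multiplicative_of_irreducible_of_fineSelmerDual_fg)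
    (hGZK : rank_eq_analyticRank_of_analyticRank_le_one) (hmod : hasEntireLFunction_rat)
    (hLim2 : Lim2017.thm35_at_two_fineSelmerDual_moduleFinite_of_classicalMuVanishes_of_le_divisionField_four)
    (hFW : ferreroWashington1979_classicalMuVanishes)
    (hAnaMult : ∀ (W : WeierstrassCurve ℚ) [W.IsElliptic] [W.IsGloballyMinimal], ¬ W.HasCM → W.analyticRank = 0 →
      Mult W 2 → W.HasIrreducibleModPGaloisRep 2 → ¬ IsAbelianGalois ℚ (W.divisionField 2) →
      ∀ (κ : ZpExtension ℚ 2), κ.IsCyclotomic →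
        ∃ (γ : Field.absoluteGaloisGroup ℚ) (D : W.FineSelmerDualData κ γ),
          Module.Finite ℤ_[2] (RestrictScalars ℤ_[2] (IwasawaAlgebra 2) D.X))
    (hRedMult : ∀ (W : WeierstrassCurve ℚ) [W.IsElliptic] [W.IsGloballyMinimal], ¬ W.HasCM → W.analyticRank = 0 →
      Mult W 2 → ¬ W.HasIrreducibleModPGaloisRep 2 → MissingUpperBoundAt W 2) :
    MultUpperHalfAtTwo := by
  intro W _ _ hcm hr hmult
  by_cases hirr : W.HasIrreducibleModPGaloisRep 2
  · exact multTwo_upper_onIrreducible_of_conjA hKM hGZK hmod hLim2 hFW hAnaMult W hcm hr hmult hirr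
  · exact hRedMult W hcm hr hmult hirr

/-! ## §5 For the additive crux's glue: BSD₂ of a multiplicative twist partner with irreducible `E[2]` -/

/-- **BSD₂ on the multiplicative `E[2]`-IRREDUCIBLE block from the two one-sided objects** — (A) on the non-abelian
part (`hAnaMult`) and the LOWER half over `ℚ` (`hLowMult`, = `MultLowerHalfAtTwo`'s content restricted to irreducible
`E[2]`) — GRANTED the reading + PRINT. For glue v7 of the additive crux (`additiveRankZeroAtTwo_of_residual_v7`): on the
169 census classes with `W^{(−1)}` split multiplicative at `2` and irreducible `E[2]`, the sibling input BSD₂(`W^{(d)}`)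
(`d ≡ 7 mod 8` with `L(E^{(d)},1) ≠ 0`; `W^{(d)}` split multiplicative at `2`, `W^{(d)}[2] ≅ W[2]` irreducible) is
{(A) at `(W^{(d)},2)`, lower half of `W^{(d)}`} — two one-sided objects over `ℚ`, no over-`K` C-part. Conditional;
closes nothing. [cite: Kato2004Asterisque, Thm. 12.5 (3) and (12.5.1) (p. 222), 13.13 (p. 233), 14.14 (p. 243)]
[cite: CoatesSujatha2005, statement (A)] [cite: Miller2011LMS, §1 and Def. 1.1] -/
theorem multTwo_bsdp_onIrreducible_of_conjA_of_lower
    (hKM : Kato2004.rankZero_padicValNat_sha_add_padicValNat_tamagawa_le_at_two_of_multiplicative_of_irreducible_of_fineSelmerDual_fg)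
    (hGZK : rank_eq_analyticRank_of_analyticRank_le_one) (hmod : hasEntireLFunction_rat)
    (hLim2 : Lim2017.thm35_at_two_fineSelmerDual_moduleFinite_of_classicalMuVanishes_of_le_divisionField_four)
    (hFW : ferreroWashington1979_classicalMuVanishes)
    (hAnaMult : ∀ (W : WeierstrassCurve ℚ) [W.IsElliptic] [W.IsGloballyMinimal], ¬ W.HasCM → W.analyticRank = 0 →
      Mult W 2 → W.HasIrreducibleModPGaloisRep 2 → ¬ IsAbelianGalois ℚ (W.divisionField 2) →
      ∀ (κ : ZpExtension ℚ 2), κ.IsCyclotomic →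
        ∃ (γ : Field.absoluteGaloisGroup ℚ) (D : W.FineSelmerDualData κ γ),
          Module.Finite ℤ_[2] (RestrictScalars ℤ_[2] (IwasawaAlgebra 2) D.X))
    (hLowMult : ∀ (W : WeierstrassCurve ℚ) [W.IsElliptic] [W.IsGloballyMinimal], ¬ W.HasCM → W.analyticRank = 0 →
      Mult W 2 → W.HasIrreducibleModPGaloisRep 2 → MissingLowerBoundAt W 2) :
    ∀ (W : WeierstrassCurve ℚ) [W.IsElliptic] [W.IsGloballyMinimal], ¬ W.HasCM → W.analyticRank = 0 →
      Mult W 2 → W.HasIrreducibleModPGaloisRep 2 → BSDp W 2 := by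
  intro W _ _ hcm hr hmult hirr
  have hr1 : W.analyticRank ≤ 1 := by rw [hr]; exact zero_le_one
  exact bsdp_of_missingPPartAt W 2 hGZK hr1
    (missingPPartAt_of_lower_of_upper W 2 (hLowMult W hcm hr hmult hirr)
      (multTwo_upper_onIrreducible_of_conjA hKM hGZK hmod hLim2 hFW hAnaMult W hcm hr hmult hirr))

/-- **The whole multiplicative sibling from its children with the Kato half SHARPENED on the irreducible locus**: the
landed glue `MultiplicativeRankZeroAtTwoOfChildren` (19924, PROVED: `multiplicativeRankZeroAtTwoOfChildren_holds`, used by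
name) consumes `MultUpperHalfAtTwo`; composing with §4 gives `MultiplicativeRankZeroAtTwo` from {`hGZK` =
`MultPublishedInputsAtTwo`, `MultLowerHalfAtTwo`} + {reading, (A) on the irreducible non-abelian classes, upper half on
the REDUCIBLE classes} — the form in which the additive crux's v7 may read its sibling. Pure composition; conditional;
closes nothing. [cite: Kato2004Asterisque, Thm. 12.5 (3) (p. 222), 14.14 (p. 243)] [cite: CoatesSujatha2005, statement (A)] -/
theorem multiplicativeRankZeroAtTwo_of_katoAtTwoMult_of_conjA_of_reducible_of_lower
    (hKM : Kato2004.rankZero_padicValNat_sha_add_padicValNat_tamagawa_le_at_two_of_multiplicative_of_irreducible_of_fineSelmerDual_fg)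
    (hGZK : rank_eq_analyticRank_of_analyticRank_le_one) (hmod : hasEntireLFunction_rat)
    (hLim2 : Lim2017.thm35_at_two_fineSelmerDual_moduleFinite_of_classicalMuVanishes_of_le_divisionField_four)
    (hFW : ferreroWashington1979_classicalMuVanishes)
    (hAnaMult : ∀ (W : WeierstrassCurve ℚ) [W.IsElliptic] [W.IsGloballyMinimal], ¬ W.HasCM → W.analyticRank = 0 →
      Mult W 2 → W.HasIrreducibleModPGaloisRep 2 → ¬ IsAbelianGalois ℚ (W.divisionField 2) →
      ∀ (κ : ZpExtension ℚ 2), κ.IsCyclotomic →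
        ∃ (γ : Field.absoluteGaloisGroup ℚ) (D : W.FineSelmerDualData κ γ),
          Module.Finite ℤ_[2] (RestrictScalars ℤ_[2] (IwasawaAlgebra 2) D.X))
    (hRedMult : ∀ (W : WeierstrassCurve ℚ) [W.IsElliptic] [W.IsGloballyMinimal], ¬ W.HasCM → W.analyticRank = 0 →
      Mult W 2 → ¬ W.HasIrreducibleModPGaloisRep 2 → MissingUpperBoundAt W 2)
    (hLow : MultLowerHalfAtTwo) :
    MultiplicativeRankZeroAtTwo :=
  multiplicativeRankZeroAtTwoOfChildren_holds hGZK
    (multUpperHalfAtTwo_of_katoAtTwoMult_of_conjA_of_reducible hKM hGZK hmod hLim2 hFW hAnaMult hRedMult) hLow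

end Summit.BirchSwinnertonDyer.BirchSwinnertonDyer.Theorems.SemistableKatoTwo

end
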